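import Summits.CriticalPhenomena.Ising3D.IsingColumnFaceL11CensusSegmentTrg

/-!
# The `TRG` census of §7.3 on the certified `Δε` segment as kernel facts, IV: the kernel evaluations of
the `Γ`-classes `Γ(⅓)^b`, `b = −3, −2, −1` (cell `pub-ising3x`, seat recog-1; paper §7.1 / §7.3)

HONEST FRAMING: lottery ticket; floor = tightest certified 3D Ising CFT bounds; no exact-solution
claim without a proof. Island framing: certified exclusion region at stated derivative order and
assumptions; not a determination of the 3D Ising critical exponents beyond that.

Kernel evaluations `trgSegCheck g b n₀ n₁ n₂ = true` of the enumerate-and-decide machine of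
`IsingColumnFaceL11CensusSegmentTrg.lean` (one `decide +kernel` per `Γ`-class; this file ≈ 100 s of kernel
time): every candidate of the class is decided, the tuple codes strictly increase, and the class has
`n₀ / n₁ / n₂` lowest-terms candidates in the sub-window bins `[81/64, 13/10]` / `[13/10, 27/20]` /
`[27/20, 2855/2048]`. The counts are the Python twin's (recog-1 gen 51 `twin_lintrg.py`, same enclosures); the
kernel CONFIRMS them here. Companions: `…SegmentTrgA.lean` (`Γ(¼)^b`, `b = −4, …, 0`), `…SegmentTrgB.lean` (`Γ(¼)^b`, `b = 1, …, 4`), `…SegmentTrgD.lean` (`Γ(⅓)^b`, `b = 1, 2, 3`, and the theorems). Pure arithmetic; no certificate, no datum, no σ–ε axiom;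
nothing is recognised.
lottery ticket; floor = tightest certified 3D Ising CFT bounds; no exact-solution claim without a proof.
-/

namespace Summit.CriticalPhenomena.Ising3D
namespace ColumnFaceL11
open Set Literature.MathematicalPhysics.QuantumFieldTheory.ConformalBootstrap3D

/-- `Γ`-class `(1, -3)` (`Γ(⅓)^{-3}`): all candidates decided, codes increasing, `775 / 1025 / 884`
lowest-terms candidates in the three sub-window bins. [folklore] -/
theorem trgSegCheck_1_m3 : trgSegCheck 1 (-3) 775 1025 884 = true := by
  decide +kernel

/-- `Γ`-class `(1, -2)` (`Γ(⅓)^{-2}`): all candidates decided, codes increasing, `914 / 1267 / 1099`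
lowest-terms candidates in the three sub-window bins. [folklore] -/
theorem trgSegCheck_1_m2 : trgSegCheck 1 (-2) 914 1267 1099 = true := by
  decide +kernel

/-- `Γ`-class `(1, -1)` (`Γ(⅓)^{-1}`): all candidates decided, codes increasing, `957 / 1376 / 1154`
lowest-terms candidates in the three sub-window bins. [folklore] -/
theorem trgSegCheck_1_m1 : trgSegCheck 1 (-1) 957 1376 1154 = true := by
  decide +kernel

end ColumnFaceL11
end Summit.CriticalPhenomena.Ising3D
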